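import Summits.RiemannHypothesis.RiemannHypothesis.Theorems.ScrewManifestCertResidual

/-!
# ScrewManifestCertDual8 — part of the integer-screw manifest-certificate development

Batch 3E, second part (`dual8PairingNeg_holds : Dual8PairingNeg` PROVED, hence
`nyquistFloor_of_D16_and_wave8`) and Batch 3F, first part: `Q, Q′, Q″` as explicit double sums and
the analytic glue (cell bound, convex start, second-order Taylor bound, `quad_nonneg`).
(Split of `ScrewManifestCert.lean` v1.5 for the Theorems line cap; overview and file layout in
`Summits.RiemannHypothesis.RiemannHypothesis.Theorems.ScrewManifestCertDefs`.
Nothing in this file bears on the truth of RH.)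
-/

set_option linter.dupNamespace false
set_option autoImplicit false

namespace Summit.RiemannHypothesis.RiemannHypothesis.Theorems.IntegerScrew.Manifest

open Literature.NumberTheory.LFunctions Matrix

section Batch3E

open Literature.Analysis.ValidatedNumerics Literature.Analysis.ValidatedNumerics.Numerics Finset

/-- `2^48·⟨T(c_lo), Y⟩ ≤ ZB` from the entry enclosures. -/
theorem frob_tMat_le_ZB {utab : List (List FI)}
    (hut : ∀ a b : ℕ, 0 < b → b < a → a ≤ 7 + 1 →
      FI.mem (RungCert.uR a b) (RungCert.ug utab a b)) :
    frob (RungCert.tMat ((RungCert.cLoQ : ℚ) : ℝ) 7) y8 * SC ≤ (ZB utab : ℝ) := by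
  unfold frob ZB
  rw [Finset.sum_mul]
  push_cast
  refine Finset.sum_le_sum fun i _ => ?_
  rw [Finset.sum_mul]
  refine Finset.sum_le_sum fun j _ => ?_
  have hm : FI.mem (RungCert.tMat ((RungCert.cLoQ : ℚ) : ℝ) 7 i j) (RungCert.tEncl utab i j) := by
    have := RungCert.mem_tEncl hut i.isLt j.isLt
    simpa using this
  obtain ⟨hlo, hhi⟩ := hm
  simp only [y8, Matrix.of_apply, zb]
  split_ifs with h
  · push_cast
    have hy : (0 : ℝ) ≤ (y8K i j : ℝ) := by exact_mod_cast h
    calc RungCert.tMat ((RungCert.cLoQ : ℚ) : ℝ) 7 i j * (y8K i j : ℝ) * SC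
        = (RungCert.tMat ((RungCert.cLoQ : ℚ) : ℝ) 7 i j * SC) * (y8K i j : ℝ) := by ring
      _ ≤ ((RungCert.tEncl utab i j).hi : ℝ) * (y8K i j : ℝ) := mul_le_mul_of_nonneg_right hhi hy
  · push_cast
    have hy : (y8K i j : ℝ) ≤ 0 := by exact_mod_cast (not_le.1 h).le
    calc RungCert.tMat ((RungCert.cLoQ : ℚ) : ℝ) 7 i j * (y8K i j : ℝ) * SC
        = (RungCert.tMat ((RungCert.cLoQ : ℚ) : ℝ) 7 i j * SC) * (y8K i j : ℝ) := by ring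
      _ ≤ ((RungCert.tEncl utab i j).lo : ℝ) * (y8K i j : ℝ) := mul_le_mul_of_nonpos_right hlo hy

/-- `⟨I + J, Y⟩ = P8` (cast). -/
theorem frob_one_add_ones_y8 :
    frob (1 + Matrix.vecMulVec (fun _ : Fin 7 => (1 : ℝ)) fun _ => 1) y8 = (P8 : ℝ) := by
  unfold frob P8
  push_cast
  simp only [Matrix.add_apply, Matrix.one_apply, Matrix.vecMulVec_apply, y8, Matrix.of_apply, mul_one,
    add_mul, ite_mul, one_mul, zero_mul, Finset.sum_add_distrib, Finset.sum_ite_eq, Finset.mem_univ,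
    if_true]

/-- **PROVED (gen16, KERNEL): the `M = 8` dual of record pairs negatively with `S_8`.** -/
theorem dual8PairingNeg_holds : Dual8PairingNeg := by
  have h := dual8Check_eq_true
  unfold dual8Check at h
  rw [Bool.and_eq_true] at h
  obtain ⟨hok, hm⟩ := h
  have hL : ∀ n : ℕ, n ≤ 8 → FI.mem (Real.log n) (RungCert.lg logs8 n) :=
    RungCert.logsOK_of_eq rfl hok
  split at hm
  · exact absurd hm (by simp)
  · rename_i A hA
    rw [decide_eq_true_eq] at hm
    have hAv : FI.mem RungCert.slopeA A := RungCert.mem_slopeEncl hL (by norm_num) hA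
    have hut : ∀ a b : ℕ, 0 < b → b < a → a ≤ 7 + 1 →
        FI.mem (RungCert.uR a b) (RungCert.ug (RungCert.uTable logs8 A 7) a b) := by
      intro a b hb hba ha
      rw [RungCert.ug_uTable hba ha]
      exact RungCert.mem_uEncl hL (by norm_num) hAv hb hba ha
    have hS : (0 : ℝ) < SC := SC_pos
    have hZ := frob_tMat_le_ZB hut
    have hC := lerchC_le_cHiQ
    have hClo : ((RungCert.cLoQ : ℚ) : ℝ) ≤ RungCert.lerchC := RungCert.cLoQ_le_lerchC
    have hP : (0 : ℝ) ≤ (P8 : ℝ) := by exact_mod_cast P8_nonneg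
    have hmR : (4 : ℝ) * (ZB (RungCert.uTable logs8 A 7) : ℝ) +
        (SC : ℝ) * (((cHiQ : ℚ) : ℝ) - ((RungCert.cLoQ : ℚ) : ℝ)) * (P8 : ℝ) < 0 := by
      exact_mod_cast hm
    unfold Dual8PairingNeg
    rw [RungCert.screwMatrix_eq_tMat, RungCert.tMat_split RungCert.lerchC ((RungCert.cLoQ : ℚ) : ℝ),
      frob_add_left, frob_smul_left, frob_one_add_ones_y8]
    have h1 : (RungCert.lerchC - ((RungCert.cLoQ : ℚ) : ℝ)) / 4 * (P8 : ℝ) ≤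
        (((cHiQ : ℚ) : ℝ) - ((RungCert.cLoQ : ℚ) : ℝ)) / 4 * (P8 : ℝ) :=
      mul_le_mul_of_nonneg_right (by linarith) hP
    have h2 : frob (RungCert.tMat ((RungCert.cLoQ : ℚ) : ℝ) 7) y8 ≤
        (ZB (RungCert.uTable logs8 A 7) : ℝ) / SC := by
      rw [le_div_iff₀ hS]; exact hZ
    have h3 : (ZB (RungCert.uTable logs8 A 7) : ℝ) / SC +
        (((cHiQ : ℚ) : ℝ) - ((RungCert.cLoQ : ℚ) : ℝ)) / 4 * (P8 : ℝ) < 0 := by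
      have hS0 : (SC : ℝ) ≠ 0 := hS.ne'
      have heq : ((ZB (RungCert.uTable logs8 A 7) : ℝ) / SC +
          (((cHiQ : ℚ) : ℝ) - ((RungCert.cLoQ : ℚ) : ℝ)) / 4 * (P8 : ℝ)) * (4 * SC) =
          4 * (ZB (RungCert.uTable logs8 A 7) : ℝ) +
            (SC : ℝ) * (((cHiQ : ℚ) : ℝ) - ((RungCert.cLoQ : ℚ) : ℝ)) * (P8 : ℝ) := by
        field_simp
      exact neg_of_mul_neg_left (by rw [heq]; exact hmR) (mul_nonneg (by norm_num) hS.le)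
    linarith

/-- **PROVED (gen16 bottom line after Batch 3E):** `NyquistFloor` from the `D16` first lemma and the
wave-positivity of the `M = 8` dual alone. -/
theorem nyquistFloor_of_D16_and_wave8 (h : TopBlockD16Works) (hpos : Dual8WavePos 20) : NyquistFloor :=
  nyquistFloor_of_D16_and_dual8 h dual8PairingNeg_holds hpos

end Batch3E

/-! ## Batch 3F (gen16) — `Dual8WavePos 20` by a kernel interval-arithmetic certificate

`Q(t) := t²·⟨A_t, Y⟩ = Σ_ij (2^41 Y)_ij (1 − cos(t x_i) − cos(t x_j) + cos(t(x_i − x_j)))`, `x_i = log(i+2)`,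
is certified `≥ 0` on `[0, 20]`:
* on `[20/1024, 20]` by an ADAPTIVE GRID: on each cell `[a, a+h]`, `Q(t) ≥ Q(a) + min(0, inf_cell Q′)·h`
  (mean value inequality `Convex.mul_sub_le_image_sub_of_le_deriv`), with `Q(a)` enclosed at the point
  and `Q′` enclosed over the cell by the engine's `FI.cosSin` (7 calls per evaluation: the 21 difference
  angles come from the addition theorems) — `runCells`;
* on `[0, 20/1024]` by CONVEXITY: `Q(0) = Q′(0) = 0` and `Q″ ≥ 0` there (zero-order cell enclosures of
  `Q″`, `runZero`), so `Q′ ≥ 0` and `Q ≥ 0`.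
All checks are one Boolean `dual8WaveCheck = true` proved by `decide +kernel` (in segments).  Hence
`dual8WavePos_holds : Dual8WavePos 20`, `floorAtEight_20 : FloorAtEight 20`, and the gen16 bottom line
in final form **`nyquistFloor_of_D16' : TopBlockD16Works → NyquistFloor`**.  Nothing here bears on RH. -/

section Batch3F

open Literature.Analysis.ValidatedNumerics Literature.Analysis.ValidatedNumerics.Numerics Finset

/-! ### Real side: `Q`, `Q′`, `Q″` as explicit double sums over `range 7` -/

/-- `x_i = log(i+2)` on `ℕ` indices. -/
noncomputable def xN (i : ℕ) : ℝ := Real.log ((i + 2 : ℕ) : ℝ)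

/-- `2^41 Y` on `ℕ` indices (zero outside `7 × 7`). -/
def yz (i j : ℕ) : ℤ := if h : i < 7 ∧ j < 7 then y8K ⟨i, h.1⟩ ⟨j, h.2⟩ else 0

/-- `yz` agrees with `y8K` on `Fin 7` indices. -/
theorem yz_fin (i j : Fin 7) : yz i j = y8K i j := by
  simp [yz, i.isLt, j.isLt]

/-- `Q(t) = t² ⟨A_t, Y⟩·2^41`. -/
noncomputable def Qf (t : ℝ) : ℝ := ∑ i ∈ range 7, ∑ j ∈ range 7,
  (yz i j : ℝ) * (1 - Real.cos (t * xN i) - Real.cos (t * xN j) + Real.cos (t * (xN i - xN j)))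

/-- `Q′`. -/
noncomputable def Qd (t : ℝ) : ℝ := ∑ i ∈ range 7, ∑ j ∈ range 7,
  (yz i j : ℝ) * (xN i * Real.sin (t * xN i) + xN j * Real.sin (t * xN j)
    - (xN i - xN j) * Real.sin (t * (xN i - xN j)))

/-- `Q″`. -/
noncomputable def Qdd (t : ℝ) : ℝ := ∑ i ∈ range 7, ∑ j ∈ range 7,
  (yz i j : ℝ) * (xN i ^ 2 * Real.cos (t * xN i) + xN j ^ 2 * Real.cos (t * xN j)
    - (xN i - xN j) ^ 2 * Real.cos (t * (xN i - xN j)))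

/-- Derivative of `u ↦ cos (u c)`. -/
theorem hasDerivAt_cos_mul (c t : ℝ) : HasDerivAt (fun u : ℝ => Real.cos (u * c)) (-(c * Real.sin (t * c))) t := by
  have := (hasDerivAt_mul_const c (x := t)).cos
  convert this using 1; ring

/-- Derivative of `u ↦ sin (u c)`. -/
theorem hasDerivAt_sin_mul (c t : ℝ) : HasDerivAt (fun u : ℝ => Real.sin (u * c)) (c * Real.cos (t * c)) t := by
  have := (hasDerivAt_mul_const c (x := t)).sin
  convert this using 1; ring

/-- `Qd` is the derivative of `Qf`. -/
theorem hasDerivAt_Qf (t : ℝ) : HasDerivAt Qf (Qd t) t := by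
  unfold Qf Qd
  refine HasDerivAt.fun_sum fun i _ => HasDerivAt.fun_sum fun j _ => ?_
  have h : HasDerivAt (fun u : ℝ => (yz i j : ℝ) * (1 - Real.cos (u * xN i) - Real.cos (u * xN j)
      + Real.cos (u * (xN i - xN j)))) _ t :=
    ((((hasDerivAt_const t (1 : ℝ)).sub (hasDerivAt_cos_mul (xN i) t)).sub
      (hasDerivAt_cos_mul (xN j) t)).add (hasDerivAt_cos_mul (xN i - xN j) t)).const_mul _
  exact h.congr_deriv (by ring)

/-- `Qdd` is the derivative of `Qd`. -/
theorem hasDerivAt_Qd (t : ℝ) : HasDerivAt Qd (Qdd t) t := by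
  unfold Qd Qdd
  refine HasDerivAt.fun_sum fun i _ => HasDerivAt.fun_sum fun j _ => ?_
  have h : HasDerivAt (fun u : ℝ => (yz i j : ℝ) * (xN i * Real.sin (u * xN i)
      + xN j * Real.sin (u * xN j) - (xN i - xN j) * Real.sin (u * (xN i - xN j)))) _ t :=
    ((((hasDerivAt_sin_mul (xN i) t).const_mul (xN i)).add
      ((hasDerivAt_sin_mul (xN j) t).const_mul (xN j))).sub
      ((hasDerivAt_sin_mul (xN i - xN j) t).const_mul (xN i - xN j))).const_mul _
  exact h.congr_deriv (by ring)

/-- `Q(0) = 0`. -/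
theorem Qf_zero : Qf 0 = 0 := by simp [Qf]

/-- `Q′(0) = 0`. -/
theorem Qd_zero : Qd 0 = 0 := by simp [Qd]

/-- `⟨A_t, Y⟩ = Q(t)/t²`. -/
theorem frob_waveAtom_y8 (t : ℝ) : frob (waveAtom 7 t) y8 = Qf t / t ^ 2 := by
  unfold frob waveAtom y8 Qf
  simp only [Matrix.of_apply, node, Finset.sum_range, yz_fin, Finset.sum_div, xN]
  refine Finset.sum_congr rfl fun i _ => Finset.sum_congr rfl fun j _ => ?_
  ring

/-! ### Analytic glue: first-order cell bound and convex start -/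

/-- First-order cell bound (mean value inequality): on `[a, a + h]`, `f ≥ q + min(D, 0)·h` when
`q ≤ f a` and `D ≤ f′` on the cell. -/
theorem cell_bound {f f' : ℝ → ℝ} (hf : ∀ x, HasDerivAt f (f' x) x) {a h q D : ℝ}
    (hq : q ≤ f a) (hD : ∀ u, a ≤ u → u ≤ a + h → D ≤ f' u) :
    ∀ t, a ≤ t → t ≤ a + h → q + min D 0 * h ≤ f t := by
  intro t hat hth
  have hcont : ContinuousOn f (Set.Icc a (a + h)) := fun x _ => (hf x).continuousAt.continuousWithinAt
  have hdiff : DifferentiableOn ℝ f (interior (Set.Icc a (a + h))) :=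
    fun x _ => (hf x).differentiableAt.differentiableWithinAt
  have hder : ∀ x ∈ interior (Set.Icc a (a + h)), D ≤ deriv f x := by
    intro x hx
    have hx' := interior_subset hx
    rw [(hf x).deriv]
    exact hD x hx'.1 hx'.2
  have key := (convex_Icc a (a + h)).mul_sub_le_image_sub_of_le_deriv hcont hdiff hder a
    ⟨le_rfl, by linarith⟩ t ⟨hat, hth⟩ hat
  rcases le_or_gt 0 D with hD0 | hD0
  · rw [min_eq_right hD0]; nlinarith
  · rw [min_eq_left hD0.le]; nlinarith

/-- Convex start: `0 ≤ f 0`, `0 ≤ f′ 0` and `0 ≤ f″` on `[0, T]` give `0 ≤ f` on `[0, T]`. -/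
theorem nonneg_of_convex_start {f f' f'' : ℝ → ℝ} (hf : ∀ x, HasDerivAt f (f' x) x)
    (hf' : ∀ x, HasDerivAt f' (f'' x) x) {T : ℝ} (h0 : 0 ≤ f 0) (h0' : 0 ≤ f' 0)
    (hpos : ∀ u, 0 ≤ u → u ≤ T → 0 ≤ f'' u) : ∀ t, 0 ≤ t → t ≤ T → 0 ≤ f t := by
  have h1 : ∀ u, 0 ≤ u → u ≤ 0 + T → 0 ≤ f' u := by
    intro u hu huT
    have := cell_bound hf' (a := 0) (h := T) (q := f' 0) (D := 0) le_rfl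
      (fun v hv hvT => hpos v hv (by linarith)) u hu huT
    simp at this; linarith
  intro t ht htT
  have := cell_bound hf (a := 0) (h := T) (q := f 0) (D := 0) le_rfl h1 t ht (by linarith)
  simp at this; linarith

/-- Second-order Taylor lower bound on a cell from lower bounds for `f a`, `f′ a` and for `f″` on
the cell. -/
theorem taylor2_bound {f f' f'' : ℝ → ℝ} (hf : ∀ x, HasDerivAt f (f' x) x)
    (hf' : ∀ x, HasDerivAt f' (f'' x) x) {a h q p m : ℝ} (hq : q ≤ f a) (hp : p ≤ f' a)
    (hm : ∀ u, a ≤ u → u ≤ a + h → m ≤ f'' u) :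
    ∀ t, a ≤ t → t ≤ a + h → q + p * (t - a) + m / 2 * ((t - a) * (t - a)) ≤ f t := by
  have hG : ∀ x, HasDerivAt (fun τ => f (a + τ) - q - p * τ - m / 2 * (τ * τ))
      (f' (a + x) - p - m * x) x := by
    intro x
    have h : HasDerivAt (fun τ => f (a + τ) - q - p * τ - m / 2 * (τ * τ)) _ x :=
      ((((hf (a + x)).comp_const_add a x).sub_const q).sub ((hasDerivAt_id' x).const_mul p)).sub
        (((hasDerivAt_id' x).mul (hasDerivAt_id' x)).const_mul (m / 2))
    exact h.congr_deriv (by ring)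
  have hG' : ∀ x, HasDerivAt (fun τ => f' (a + τ) - p - m * τ) (f'' (a + x) - m) x := by
    intro x
    have h : HasDerivAt (fun τ => f' (a + τ) - p - m * τ) _ x :=
      (((hf' (a + x)).comp_const_add a x).sub_const p).sub ((hasDerivAt_id' x).const_mul m)
    exact h.congr_deriv (by ring)
  have key := nonneg_of_convex_start hG hG' (T := h)
    (by simp only [add_zero, mul_zero, sub_zero]; linarith)
    (by simp only [add_zero, mul_zero, sub_zero]; linarith)
    (fun u hu huh => by have := hm (a + u) (by linarith) (by linarith); linarith)
  intro t hat hth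
  have := key (t - a) (by linarith) (by linarith)
  rw [add_sub_cancel] at this
  linarith

/-- The quadratic minorant `q + p τ + (m/2) τ²` is nonnegative on `[0, h]`, from its endpoint
values and a case split on the position of its vertex. -/
theorem quad_nonneg {q p m h : ℝ} (hh : 0 ≤ h) (hq : 0 ≤ q) (hend : 0 ≤ q + p * h + m / 2 * (h * h))
    (hcase : m ≤ 0 ∨ 0 ≤ p ∨ m * h ≤ -p ∨ p * p ≤ 2 * m * q) :
    ∀ τ, 0 ≤ τ → τ ≤ h → 0 ≤ q + p * τ + m / 2 * (τ * τ) := by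
  intro τ h0 h1
  rcases le_or_gt m 0 with hm | hm
  · rcases eq_or_lt_of_le hh with hh0 | hh0
    · have hτ : τ = 0 := by linarith
      subst hτ; simpa using hq
    · have key : h * (q + p * τ + m / 2 * (τ * τ)) =
          (h - τ) * q + τ * (q + p * h + m / 2 * (h * h)) + (-m / 2) * (τ * ((h - τ) * h)) := by ring
      have hpos : 0 ≤ h * (q + p * τ + m / 2 * (τ * τ)) := by
        rw [key]
        have h3 : 0 ≤ (-m / 2) * (τ * ((h - τ) * h)) :=
          mul_nonneg (by linarith) (mul_nonneg h0 (mul_nonneg (by linarith) hh))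
        nlinarith [mul_nonneg (sub_nonneg.2 h1) hq, mul_nonneg h0 hend]
      exact (mul_nonneg_iff_of_pos_left hh0).1 hpos
  · rcases hcase with hm' | hp | hturn | hdisc
    · exact absurd hm' (not_le.2 hm)
    · nlinarith [mul_nonneg h0 hp, mul_nonneg (mul_nonneg hm.le h0) h0]
    · have key : q + p * τ + m / 2 * (τ * τ) =
          (q + p * h + m / 2 * (h * h)) + (h - τ) * (-(p + m / 2 * (τ + h))) := by ring
      rw [key]
      have h2 : 0 ≤ -(p + m / 2 * (τ + h)) := by nlinarith
      nlinarith [mul_nonneg (sub_nonneg.2 h1) h2]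
    · have key : 2 * m * (q + p * τ + m / 2 * (τ * τ)) =
          (m * τ + p) * (m * τ + p) + (2 * m * q - p * p) := by ring
      have h2 : 0 ≤ 2 * m * (q + p * τ + m / 2 * (τ * τ)) := by
        rw [key]; nlinarith [mul_self_nonneg (m * τ + p)]
      rcases le_or_gt 0 (q + p * τ + m / 2 * (τ * τ)) with h3 | h3
      · exact h3
      · exfalso
        have : 2 * m * (q + p * τ + m / 2 * (τ * τ)) < 0 := mul_neg_of_pos_of_neg (by linarith) h3
        linarith


end Batch3F

end Summit.RiemannHypothesis.RiemannHypothesis.Theorems.IntegerScrew.Manifest
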